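import Literature.NumberTheory.GaloisCohomology.Howard2004.InertLocalPairingInvarianceProofs
import Literature.NumberTheory.GaloisCohomology.Howard2004.RelaxedSelmerLagrangianCountProofs
import Literature.NumberTheory.GaloisCohomology.Howard2004.DualityDatumLocalCupScalarReadingProofs
import Literature.Algebra.Module.IsotropicLineParity
import HarnessLib

/-!
# Howard 2004, Lemma 1.5.3: the dichotomy «`loc_ℓ(H¹_{F^ℓ(n)}(K, T̄)^±)` lies in `H¹_f(K_ℓ, T̄)^±` or in
# `H¹_tr(K_ℓ, T̄)^±`» (the `hor` letter of `EigenSelmerParityProofs`) from local Tate duality on the eigenparts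

Topic `NumberTheory/GaloisCohomology/Howard2004`. THEOREMS ONLY: no definition, no named fact, no instance, no
notation, no `sorry`. Cell `pub/bsd-print-x9`, print leaf G87
`Literature.NumberTheory.GaloisCohomology.Howard2004.thm161_dvrKolyvaginBound` (Howard Thm. 1.6.1); seat
`bsd-line-x10b-p1-w5` g8, sequel to (TAU-INV) (`InertLocalPairingSymmetryProofs`, `InertLocalPairingInvarianceProofs`,
`InertLocalPairingOfLiftsProofs`).

SOURCE. B. Howard, *The Heegner point Kolyvagin system*, Compositio Math. **140** (2004) = arXiv:1202.6340, Lemma 1.5.3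
(arXiv 2.5.3), proof of (b) (p. 10 L27–40): «If `c ∈ H¹_{F^ℓ(n)}(K, T̄)^±` then the local image of `c` at `ℓ` is
self-orthogonal under the local pairing … Therefore the localization of `H¹_{F^ℓ(n)}(K, T̄)^±` at `ℓ` is a maximal
isotropic subspace of `H¹(K_ℓ, T̄)^±` and an elementary linear algebra exercise shows that the only two such subspaces are
`H¹_f(K_ℓ, T̄)^±` and `H¹_tr(K_ℓ, T̄)^±`.» The cell's `EigenSelmerParityProofs` (w5 g7) takes this DICHOTOMY as the
hypothesis `hor : loc_q(S ⊓ E) ≤ Lf ∨ loc_q(S ⊓ E) ≤ Lt`; `Algebra/Module/IsotropicLineParity` §6 reduces it to a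
cross-term `hcross : B u v + B v u ≠ 0` on the eigenLINES. THIS FILE proves `hor` with `hcross` DISCHARGED from the
Galois letters now in the kernel: symmetry of `⟨ , ⟩_q` on same-sign eigenclasses (`InertLocalPairingSymmetryProofs`),
orthogonality of opposite eigenparts (`InertLocalPairingInvarianceProofs` + `…OfLiftsProofs`), and local Tate duality.

WHAT IS PROVED.
* §1 (module-theoretic core, namespace `Literature.Algebra.Module`)
  **`AddSubgroup.le_or_le_of_isotropic_of_eigen_of_nondegenerate`**: for bi-additive `B : V × V → P`, additive `τ`,
  `ε : ℤ`, `V = Lf + Lt` disjoint `τ`-stable ISOTROPIC subgroups, symmetry of `B` on same-sign eigenvectors,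
  orthogonality of opposite eigenparts, `Lt = Lt^ε + Lt^{−ε}` with `Lt^ε` a line (in the weak form «`B`-orthogonal to one
  non-zero `ε`-eigenvector of `Lt` ⇒ `B`-orthogonal to all of `Lt^ε`»), `B` left non-degenerate, `P` without `2`-torsion:
  every subgroup `S` of `ε`-eigenvectors with `B(S, S) = 0` has `S ≤ Lf ∨ S ≤ Lt` (via
  `Submodule.le_or_le_of_isotropic_of_eigen` over `ℤ`; the cross-term is `2 B u v`, and `B u v = 0` would make `u`
  orthogonal to `Lf + Lt^{−ε} + Lt^ε = V`).
* §2 (letters at an inert `q`, namespace `…Howard2004.DualityDatum`) `eq_zero_of_two_nsmul_eq_zero_of_odd` (`N` odd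
  kills `P` ⇒ no `2`-torsion; `N = p^k`), `localCup_transportH1_cast_eq_zero_of_exists_smul` (the LINE letter in
  orthogonality form from the `R`-span form, `⟨u, r • v⟩_q = H²(r•)⟨u, v⟩_q`),
  **`localCup_transportH1_cast_eq_zero_of_eq_of_eq_neg_of_readings`** (`H¹(K_q,T̄)⁺ ⊥ H¹(K_q,T̄)⁻` at the `H²`-LEVEL from a
  `G_ℚ`-compatible family of readings that SEPARATES `H²(K_q, R̄(1))`).
* §3 **`map_inf_le_or_le_of_isotropic_of_eigen`** — (DICH) itself, VERBATIM the `hor` of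
  `EigenSelmerParityProofs.length_inf_comap_add_one_eq_of_exists` / `…_eq_add_one_of_forall` at the place `Sum.inr q`:
  `(S ⊓ E).map loc_q ≤ Lf ∨ (S ⊓ E).map loc_q ≤ Lt`, for `τ_* = ε` on `E` (`ε = ±1`) and `loc_q(S)` isotropic, modulo the
  letters (all with producers in the tree): `hdis`/`hsplit` (Prop. 1.1.9: `InertTameGeneratorRingClassProofs`,
  `TransverseComplementOfCyclicProofs`), `hstabf` (`InertLocalTauUnramifiedProofs`), `hstabt` (`TransportTransverseProofs`),
  `hf` (`UnramifiedIsotropy`), `ht` (`TransverseIsotropyProofs`), `horth` (§2), `hdecT`/`hline` (H.5(a) at `q`: the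
  eigenLINES of `τ_q` on `H¹_tr ≅ T̄`), `hnd` (`RelaxedSelmerLagrangianCountProofs.eq_zero_of_forall_localCup_transportH1_cast_eq_zero`),
  `h2` (§2), `hiso` (`RelaxedSelmerIsotropyProofs` + separation of readings).

NOT HERE: the eigenline structure of `H¹_tr(K_q, T̄)` under `τ_q` (H.5(a) transported; «`ker(Θ_q ∓ 1)` is a line»), the
separation of `H²(K_q, R̄(1))` by readings, the (GD-line) count; `thm161_dvrKolyvaginBound` is NOT proved; no summit
statement is proved; the Birch–Swinnerton-Dyer conjecture is not proved by any of this.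
References: [Howard2004HeegnerKolyvagin] Lemma 1.5.3, Prop. 1.1.9, H.4/H.5; [MilneADT2006] I Cor. 2.3;
[SerreGaloisCohomology1997] I §2.2.
-/

set_option autoImplicit false

noncomputable section

open Function NumberField IsDedekindDomain Field CategoryTheory
open scoped NumberField

/-! ## §1 The module-theoretic core: the cross-term from non-degeneracy on the eigenlines -/

namespace Literature.Algebra.Module

section Core

variable {V P : Type*} [AddCommGroup V] [AddCommGroup P]

/-- **The «elementary linear algebra exercise» of Howard's Lemma 1.5.3 with `hcross` DISCHARGED from non-degeneracy.**
Let `B : V × V → P` be bi-additive, `τ` an additive endomorphism of `V`, `ε = ±1`; `Lf`, `Lt ≤ V` with `V = Lf + Lt`,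
`τ`-stable, each ISOTROPIC (`B = 0` on `Lf × Lf` and on `Lt × Lt`); suppose: (symmetry) `B v u = B u v` for `ε`-eigenvectors
`u ∈ Lf`, `v ∈ Lt`; (orthogonality of opposite eigenparts) `B u w = 0` for `u ∈ Lf` an `ε`-eigenvector and `w ∈ Lt` a
`(−ε)`-eigenvector; `Lt = Lt^ε + Lt^{−ε}`; the `ε`-eigenpart of `Lt` is a LINE in the weak form «whatever is
`B`-orthogonal to one non-zero `ε`-eigenvector `v ∈ Lt` is `B`-orthogonal to all of `Lt^ε`»; `B` is left
non-degenerate; `P` has no `2`-torsion. Then every subgroup `S` of `ε`-eigenvectors on which `B` vanishes identically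
satisfies `S ≤ Lf ∨ S ≤ Lt`. (The cross-term `B u v + B v u = 2 B u v` is non-zero: else `u ⊥ Lf + Lt^{−ε} + Lt^ε = V`,
so `u = 0`.) [cite: Howard2004HeegnerKolyvagin, Lemma 1.5.3 proof (arXiv:1202.6340, p. 10 L34–40: «an elementary linear algebra exercise shows that the only two such subspaces are `H¹_f(K_ℓ, T̄)^±` and `H¹_tr(K_ℓ, T̄)^±`»)] -/
theorem AddSubgroup.le_or_le_of_isotropic_of_eigen_of_nondegenerate (B : V →+ V →+ P) (τ : V →+ V) (ε : ℤ)
    (Lf Lt S : AddSubgroup V) (hdis : Disjoint Lf Lt) (hsplit : ∀ y : V, ∃ a ∈ Lf, ∃ b ∈ Lt, y = a + b)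
    (hstabf : ∀ u ∈ Lf, τ u ∈ Lf) (hstabt : ∀ v ∈ Lt, τ v ∈ Lt)
    (hf : ∀ u ∈ Lf, ∀ u' ∈ Lf, B u u' = 0) (ht : ∀ v ∈ Lt, ∀ v' ∈ Lt, B v v' = 0)
    (hsymm : ∀ u ∈ Lf, ∀ v ∈ Lt, τ u = ε • u → τ v = ε • v → B v u = B u v)
    (horth : ∀ u ∈ Lf, ∀ w ∈ Lt, τ u = ε • u → τ w = -(ε • w) → B u w = 0)
    (hdecT : ∀ b ∈ Lt, ∃ b₁ ∈ Lt, ∃ b₂ ∈ Lt, τ b₁ = ε • b₁ ∧ τ b₂ = -(ε • b₂) ∧ b = b₁ + b₂)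
    (hline : ∀ v ∈ Lt, τ v = ε • v → v ≠ 0 → ∀ b ∈ Lt, τ b = ε • b → ∀ u : V, B u v = 0 → B u b = 0)
    (hnd : ∀ u : V, (∀ y, B u y = 0) → u = 0) (h2 : ∀ z : P, 2 • z = 0 → z = 0)
    (hS : ∀ x ∈ S, τ x = ε • x) (hiso : ∀ x ∈ S, ∀ y ∈ S, B x y = 0) :
    S ≤ Lf ∨ S ≤ Lt := by
  -- `ℤ`-linear packaging
  let Bl : V →ₗ[ℤ] V →ₗ[ℤ] P := LinearMap.mk₂ ℤ (fun x y => B x y)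
    (fun x x' y => by rw [map_add, AddMonoidHom.add_apply])
    (fun c x y => by rw [map_zsmul, AddMonoidHom.zsmul_apply])
    (fun x y y' => map_add (B x) y y') (fun c x y => map_zsmul (B x) c y)
  have hBl : ∀ x y, Bl x y = B x y := fun _ _ => rfl
  let τl : V →ₗ[ℤ] V := τ.toIntLinearMap
  have hτl : ∀ x, τl x = τ x := fun _ => rfl
  have key := Submodule.le_or_le_of_isotropic_of_eigen Bl τl ε (AddSubgroup.toIntSubmodule Lf)
    (AddSubgroup.toIntSubmodule Lt) (AddSubgroup.toIntSubmodule S)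
    (by
      rw [Submodule.disjoint_def]
      intro x hx hx'
      exact (AddSubgroup.disjoint_def.mp hdis) hx hx')
    (fun u hu => hstabf u hu) (fun v hv => hstabt v hv)
    (fun u hu => hf u hu u hu) (fun v hv => ht v hv v hv)
    (fun u hu heu v hv hev hu0 hv0 => by
      -- the cross-term: `B u v + B v u = 2 • B u v ≠ 0`
      rw [hBl, hBl, hsymm u hu v hv heu hev, ← two_nsmul]
      intro h0
      have hBuv : B u v = 0 := h2 _ h0
      apply hu0
      refine hnd u fun y => ?_
      obtain ⟨a, ha, b, hb, rfl⟩ := hsplit y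
      obtain ⟨b₁, hb₁, b₂, hb₂, hτ₁, hτ₂, rfl⟩ := hdecT b hb
      rw [map_add, map_add, hf u hu a ha, horth u hu b₂ hb₂ heu hτ₂,
        hline v hv hev hv0 b₁ hb₁ hτ₁ u hBuv, zero_add, add_zero])
    (fun x hx => by
      obtain ⟨a, ha, b, hb, rfl⟩ := hsplit x
      exact Submodule.mem_sup.mpr ⟨a, ha, b, hb, rfl⟩)
    (fun x hx => hS x hx) (fun x hx => hiso x hx x hx)
  rcases key with h | h
  · exact Or.inl fun x hx => h hx
  · exact Or.inr fun x hx => h hx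

end Core

end Literature.Algebra.Module

namespace Literature.NumberTheory.GaloisCohomology.Howard2004

open Literature.NumberTheory.GaloisRepresentations
open Literature.NumberTheory.GaloisRepresentations.DiscreteGaloisModule
open Literature.NumberTheory.EllipticCurves
open Literature.Algebra.Module

variable {K : Type} [Field K] [NumberField K] {Nbar : Type} [AddCommGroup Nbar]
  [TopologicalSpace Nbar] [DiscreteTopology Nbar] {R : Type} [CommRing R] [TopologicalSpace R]
  [DiscreteTopology R] [Module R Nbar] {p : ℕ} [Fact p.Prime] [Algebra ℤ_[p] R]
  {cd : ConjugationDatum K} {ρbar : DiscreteGaloisModule K Nbar}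

namespace DualityDatum

/-! ## §2 Letters at an inert prime: `p^k`-torsion ⇒ no `2`-torsion; the LINE letter from the `R`-span form;
orthogonality of opposite eigenparts at the `H²`-level from the readings -/

/-- On an abelian group killed by an ODD number `N`, `2 • z = 0 ⇒ z = 0` (`gcd(2, N) = 1`). Used with `N = p^k`,
`p` odd, on `H²(K_q, R̄(1))`. [folklore] [cite: Howard2004HeegnerKolyvagin, §1.1 (arXiv p. 5 L3–6: `p` odd throughout)] -/
theorem eq_zero_of_two_nsmul_eq_zero_of_odd {P : Type*} [AddCommGroup P] {N : ℕ} (hN : Odd N)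
    (hkill : ∀ z : P, N • z = 0) (z : P) (h2 : 2 • z = 0) : z = 0 := by
  obtain ⟨m, rfl⟩ := hN
  have h := hkill z
  rw [add_nsmul, one_nsmul, mul_nsmul, h2, nsmul_zero, zero_add] at h
  exact h

variable (Dbar : DualityDatum p cd ρbar R) (A : ResidualTau (R := R) cd ρbar) (hρ : ρbar.IsScalarLinear R)
  {q : HeightOneSpectrum (𝓞 K)} (h : cd.σ • q = q)

/-- **The LINE letter in `B`-orthogonality form from the `R`-span form.** If every `ε`-eigenclass of `Lt` is an
`R`-multiple `r • v` of a fixed one (`Lt^ε` is a line), then whatever is `⟨ , ⟩_q`-orthogonal to `v` is orthogonal to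
all of `Lt^ε`: `⟨u, r • v⟩_q = H²(r•) ⟨u, v⟩_q` (`transportH1_cast_scalarMapH1`, `localCup_scalarMapH1_right`).
[cite: Howard2004HeegnerKolyvagin, Lemma 1.5.3 proof (arXiv p. 10 L12–16: «one-dimensional eigenspaces») and Def. 1.1.1 (R-linearity)] -/
theorem localCup_transportH1_cast_eq_zero_of_exists_smul
    {u v b : galoisCohomology (ρbar.toLocal (Sum.inr q)) 1}
    (hb : ∃ r : R, b = galoisCohomology.scalarMapH1 (ρbar.toLocal (Sum.inr q))
      (DualityDatum.isScalarLinear_toLocal hρ (Sum.inr q)) r v)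
    (huv : Dbar.localCup (Sum.inr q) u (cd.transportH1 ρbar q
      (h.symm ▸ v : galoisCohomology (ρbar.toLocal (Sum.inr (cd.σ • q))) 1)) = 0) :
    Dbar.localCup (Sum.inr q) u (cd.transportH1 ρbar q
      (h.symm ▸ b : galoisCohomology (ρbar.toLocal (Sum.inr (cd.σ • q))) 1)) = 0 := by
  obtain ⟨r, rfl⟩ := hb
  rw [cd.transportH1_cast_scalarMapH1 ρbar hρ h r v,
    Dbar.localCup_scalarMapH1_right (Sum.inr q) (DualityDatum.isScalarLinear_toLocal hρ (Sum.inr q))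
      (DualityDatum.isScalarLinear_twist_toLocal cd hρ (Sum.inr q)) r, huv, map_zero]

/-- **`H¹(K_q, T̄)^ε ⊥ H¹(K_q, T̄)^{−ε}` at the `H²`-LEVEL** from the readings: if a family of additive readings
`ι_i` of `H²(K_·, R̄(1))` is `G_ℚ`-compatible at `q` (`hGQ`, e.g. `ι_i = inv ∘ H²(exp ∘ λ_i)` for the canonical datum,
`InertLocalPairingOfLiftsProofs`), has `2`-torsion-free targets, and SEPARATES the classes of `H²(K_q, R̄(1))` (`hread`),
then `⟨x, y⟩_q = 0` and `⟨y, x⟩_q = 0` whenever `τ_q x = x`, `τ_q y = −y`.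
[cite: Howard2004HeegnerKolyvagin, Lemma 1.5.3 (arXiv p. 10 L10–16)] [cite: MilneADT2006, Ch. I Cor. 2.3] -/
theorem localCup_transportH1_cast_eq_zero_of_eq_of_eq_neg_of_readings
    (hθ : ∀ x y : Nbar, Dbar.e (A.θ x) (A.θ y) = -Dbar.e x y) {I Z : Type} [AddCommGroup Z]
    (ι : I → (w : HeightOneSpectrum (𝓞 K)) → galoisCohomology (Dbar.twistOne.toLocal (Sum.inr w)) 2 →+ Z)
    (hGQ : ∀ i, ∀ x y : galoisCohomology (ρbar.toLocal (Sum.inr (cd.σ • q))) 1,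
      ι i q (haveI : CompactSpace (absoluteGaloisGroup (Place.Completion (Sum.inr q : Place K))) :=
          absoluteGaloisGroup_compactSpace _
        (DiscreteGaloisModule.pairing (ρbar.toLocal (Sum.inr q)) (ρbar.toLocal (Sum.inr q))
            (Dbar.twistOne.toLocal (Sum.inr q)) (Dbar.eHom.compl₂ A.θ.toAddMonoidHom)
            (Dbar.thetaPairing_equivariant_toLocal A (Sum.inr q))).cupProduct
          (A.thetaH1 (Sum.inr q) (cd.transportH1 ρbar q x))
          (A.thetaH1 (Sum.inr q) (cd.transportH1 ρbar q y))) =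
      ι i (cd.σ • q)
        (haveI : CompactSpace (absoluteGaloisGroup (Place.Completion (Sum.inr (cd.σ • q) : Place K))) :=
          absoluteGaloisGroup_compactSpace _
        (DiscreteGaloisModule.pairing (ρbar.toLocal (Sum.inr (cd.σ • q))) (ρbar.toLocal (Sum.inr (cd.σ • q)))
            (Dbar.twistOne.toLocal (Sum.inr (cd.σ • q))) (Dbar.eHom.compl₂ A.θ.toAddMonoidHom)
            (Dbar.thetaPairing_equivariant_toLocal A (Sum.inr (cd.σ • q)))).cupProduct x y))
    (h2 : ∀ z : Z, 2 • z = 0 → z = 0)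
    (hread : ∀ z : galoisCohomology (Dbar.twistOne.toLocal (Sum.inr q)) 2, (∀ i, ι i q z = 0) → z = 0)
    {x y : galoisCohomology (ρbar.toLocal (Sum.inr q)) 1}
    (hx : A.thetaH1 (Sum.inr q) (cd.transportH1 ρbar q
        (h.symm ▸ x : galoisCohomology (ρbar.toLocal (Sum.inr (cd.σ • q))) 1)) = x)
    (hy : A.thetaH1 (Sum.inr q) (cd.transportH1 ρbar q
        (h.symm ▸ y : galoisCohomology (ρbar.toLocal (Sum.inr (cd.σ • q))) 1)) = -y) :
    Dbar.localCup (Sum.inr q) x (cd.transportH1 ρbar q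
        (h.symm ▸ y : galoisCohomology (ρbar.toLocal (Sum.inr (cd.σ • q))) 1)) = 0 ∧
      Dbar.localCup (Sum.inr q) y (cd.transportH1 ρbar q
        (h.symm ▸ x : galoisCohomology (ρbar.toLocal (Sum.inr (cd.σ • q))) 1)) = 0 :=
  ⟨hread _ fun i => (Dbar.apply_localCup_transportH1_cast_eq_zero_of_eq_of_eq_neg A (ι i) h (hGQ i) hθ h2 hx hy).1,
    hread _ fun i => (Dbar.apply_localCup_transportH1_cast_eq_zero_of_eq_of_eq_neg A (ι i) h (hGQ i) hθ h2 hx hy).2⟩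

/-! ## §3 (DICH): `loc_q (S ⊓ E) ≤ H¹_f ∨ ≤ H¹_tr` — the `hor` letter of `EigenSelmerParityProofs` -/

/-- **Howard's Lemma 1.5.3, the dichotomy (DICH), as a kernel theorem modulo named letters.** At an inert prime
`q` (`h : σ q = q`), for a residual duality datum `Dbar` with H.5(c)-letter `hθ`, `τ`-structure `A`, a sign `ε = ±1`,
subgroups `S, E ≤ H¹(K, T̄)` with `τ_* = ε` on `E` (`E = H¹(K, T̄)^ε`) and `loc_q(S)` ISOTROPIC for `⟨ , ⟩_q`
(reciprocity + H.4 off `q`, `RelaxedSelmerIsotropyProofs`), and local conditions `Lf, Lt ≤ H¹(K_q, T̄)` which are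
complementary (Prop. 1.1.9), `τ_q`-stable, isotropic (H.4 / `UnramifiedIsotropy` / `TransverseIsotropyProofs`), with
opposite `τ_q`-eigenparts `⟨ , ⟩_q`-orthogonal (`localCup_transportH1_cast_eq_zero_of_eq_of_eq_neg_of_readings`),
`Lt = Lt^ε ⊕ Lt^{−ε}` with `Lt^ε` a LINE (H.5(a) at `q`), and `⟨ , ⟩_q` left non-degenerate
(`eq_zero_of_forall_localCup_transportH1_cast_eq_zero`, local Tate duality) on a `2`-torsion-free `H²(K_q, R̄(1))`:
**`loc_q(S ⊓ E) ≤ Lf ∨ loc_q(S ⊓ E) ≤ Lt`** — «the localization of `H¹_{F^ℓ(n)}(K, T̄)^±` at `ℓ` is a maximal isotropic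
subspace of `H¹(K_ℓ, T̄)^±` and an elementary linear algebra exercise shows that the only two such subspaces are
`H¹_f(K_ℓ, T̄)^±` and `H¹_tr(K_ℓ, T̄)^±`». This is VERBATIM the hypothesis `hor` of
`EigenSelmerParityProofs.length_inf_comap_add_one_eq_of_exists` / `length_inf_comap_eq_add_one_of_forall` (at the
place `Sum.inr q`). [cite: Howard2004HeegnerKolyvagin, Lemma 1.5.3 proof (arXiv 2.5.3, p. 10 L27–40)] -/
theorem map_inf_le_or_le_of_isotropic_of_eigen (hθ : ∀ x y : Nbar, Dbar.e (A.θ x) (A.θ y) = -Dbar.e x y)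
    {ε : ℤ} (hε : ε = 1 ∨ ε = -1) (S E : AddSubgroup (galoisCohomology ρbar 1))
    (hE : ∀ c ∈ E, semilinearH cd.isLift A.θ.toAddMonoidHom A.isSemilinear 1 c = ε • c)
    (hiso : ∀ c ∈ S, ∀ d ∈ S, Dbar.localCup (Sum.inr q) (galoisCohomology.localization ρbar (Sum.inr q) 1 c)
      (cd.transportH1 ρbar q (h.symm ▸ galoisCohomology.localization ρbar (Sum.inr q) 1 d :
        galoisCohomology (ρbar.toLocal (Sum.inr (cd.σ • q))) 1)) = 0)
    (Lf Lt : AddSubgroup (galoisCohomology (ρbar.toLocal (Sum.inr q)) 1)) (hdis : Disjoint Lf Lt)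
    (hsplit : ∀ y, ∃ a ∈ Lf, ∃ b ∈ Lt, y = a + b)
    (hstabf : ∀ u ∈ Lf, A.thetaH1 (Sum.inr q) (cd.transportH1 ρbar q
        (h.symm ▸ u : galoisCohomology (ρbar.toLocal (Sum.inr (cd.σ • q))) 1)) ∈ Lf)
    (hstabt : ∀ v ∈ Lt, A.thetaH1 (Sum.inr q) (cd.transportH1 ρbar q
        (h.symm ▸ v : galoisCohomology (ρbar.toLocal (Sum.inr (cd.σ • q))) 1)) ∈ Lt)
    (hf : ∀ u ∈ Lf, ∀ u' ∈ Lf, Dbar.localCup (Sum.inr q) u (cd.transportH1 ρbar q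
        (h.symm ▸ u' : galoisCohomology (ρbar.toLocal (Sum.inr (cd.σ • q))) 1)) = 0)
    (ht : ∀ v ∈ Lt, ∀ v' ∈ Lt, Dbar.localCup (Sum.inr q) v (cd.transportH1 ρbar q
        (h.symm ▸ v' : galoisCohomology (ρbar.toLocal (Sum.inr (cd.σ • q))) 1)) = 0)
    (horth : ∀ u ∈ Lf, ∀ w ∈ Lt,
      A.thetaH1 (Sum.inr q) (cd.transportH1 ρbar q
          (h.symm ▸ u : galoisCohomology (ρbar.toLocal (Sum.inr (cd.σ • q))) 1)) = ε • u →
        A.thetaH1 (Sum.inr q) (cd.transportH1 ρbar q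
          (h.symm ▸ w : galoisCohomology (ρbar.toLocal (Sum.inr (cd.σ • q))) 1)) = -(ε • w) →
        Dbar.localCup (Sum.inr q) u (cd.transportH1 ρbar q
          (h.symm ▸ w : galoisCohomology (ρbar.toLocal (Sum.inr (cd.σ • q))) 1)) = 0)
    (hdecT : ∀ b ∈ Lt, ∃ b₁ ∈ Lt, ∃ b₂ ∈ Lt,
      A.thetaH1 (Sum.inr q) (cd.transportH1 ρbar q
          (h.symm ▸ b₁ : galoisCohomology (ρbar.toLocal (Sum.inr (cd.σ • q))) 1)) = ε • b₁ ∧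
        A.thetaH1 (Sum.inr q) (cd.transportH1 ρbar q
          (h.symm ▸ b₂ : galoisCohomology (ρbar.toLocal (Sum.inr (cd.σ • q))) 1)) = -(ε • b₂) ∧ b = b₁ + b₂)
    (hline : ∀ v ∈ Lt, A.thetaH1 (Sum.inr q) (cd.transportH1 ρbar q
          (h.symm ▸ v : galoisCohomology (ρbar.toLocal (Sum.inr (cd.σ • q))) 1)) = ε • v → v ≠ 0 →
        ∀ b ∈ Lt, A.thetaH1 (Sum.inr q) (cd.transportH1 ρbar q
          (h.symm ▸ b : galoisCohomology (ρbar.toLocal (Sum.inr (cd.σ • q))) 1)) = ε • b →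
        ∃ r : R, b = galoisCohomology.scalarMapH1 (ρbar.toLocal (Sum.inr q))
          (DualityDatum.isScalarLinear_toLocal hρ (Sum.inr q)) r v)
    (hnd : ∀ u : galoisCohomology (ρbar.toLocal (Sum.inr q)) 1,
      (∀ y, Dbar.localCup (Sum.inr q) u (cd.transportH1 ρbar q
        (h.symm ▸ y : galoisCohomology (ρbar.toLocal (Sum.inr (cd.σ • q))) 1)) = 0) → u = 0)
    (h2 : ∀ z : galoisCohomology (Dbar.twistOne.toLocal (Sum.inr q)) 2, 2 • z = 0 → z = 0) :
    (S ⊓ E).map (galoisCohomology.localization ρbar (Sum.inr q) 1) ≤ Lf ∨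
      (S ⊓ E).map (galoisCohomology.localization ρbar (Sum.inr q) 1) ≤ Lt := by
  -- the data of the core lemma
  let Tq : galoisCohomology (ρbar.toLocal (Sum.inr q)) 1 →+
      galoisCohomology ((cd.twist ρbar).toLocal (Sum.inr q)) 1 :=
    AddMonoidHom.mk' (fun y => cd.transportH1 ρbar q
        (h.symm ▸ y : galoisCohomology (ρbar.toLocal (Sum.inr (cd.σ • q))) 1))
      (cd.transportH1_cast_add ρbar h)
  let B : galoisCohomology (ρbar.toLocal (Sum.inr q)) 1 →+ galoisCohomology (ρbar.toLocal (Sum.inr q)) 1 →+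
      galoisCohomology (Dbar.twistOne.toLocal (Sum.inr q)) 2 := (Dbar.localCup (Sum.inr q)).compl₂ Tq
  have hB : ∀ x y, B x y = Dbar.localCup (Sum.inr q) x (cd.transportH1 ρbar q
      (h.symm ▸ y : galoisCohomology (ρbar.toLocal (Sum.inr (cd.σ • q))) 1)) := fun _ _ => rfl
  let τ : galoisCohomology (ρbar.toLocal (Sum.inr q)) 1 →+ galoisCohomology (ρbar.toLocal (Sum.inr q)) 1 :=
    AddMonoidHom.mk' (fun y => A.thetaH1 (Sum.inr q) (cd.transportH1 ρbar q
        (h.symm ▸ y : galoisCohomology (ρbar.toLocal (Sum.inr (cd.σ • q))) 1)))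
      (A.thetaH1_transportH1_cast_add h)
  have hτ : ∀ y, τ y = A.thetaH1 (Sum.inr q) (cd.transportH1 ρbar q
      (h.symm ▸ y : galoisCohomology (ρbar.toLocal (Sum.inr (cd.σ • q))) 1)) := fun _ => rfl
  -- symmetry on same-sign eigenclasses (file `InertLocalPairingSymmetryProofs`, by the sign of `ε`)
  have hsymm : ∀ u ∈ Lf, ∀ v ∈ Lt, τ u = ε • u → τ v = ε • v → B v u = B u v := by
    intro u _ v _ heu hev
    rw [hτ] at heu hev
    rw [hB, hB]
    rcases hε with rfl | rfl
    · rw [one_zsmul] at heu hev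
      exact Dbar.localCup_transportH1_cast_comm_of_eq A h hθ heu hev
    · rw [neg_one_zsmul] at heu hev
      exact Dbar.localCup_transportH1_cast_comm_of_eq_neg A h hθ heu hev
  -- the LINE letter in orthogonality form
  have hline' : ∀ v ∈ Lt, τ v = ε • v → v ≠ 0 → ∀ b ∈ Lt, τ b = ε • b → ∀ u, B u v = 0 → B u b = 0 := by
    intro v hv hev hv0 b hb heb u huv
    rw [hB] at huv ⊢
    exact Dbar.localCup_transportH1_cast_eq_zero_of_exists_smul hρ h (hline v hv hev hv0 b hb heb) huv
  -- the image of `S ⊓ E` consists of `ε`-eigenclasses and is isotropic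
  have hS' : ∀ x ∈ (S ⊓ E).map (galoisCohomology.localization ρbar (Sum.inr q) 1), τ x = ε • x := by
    rintro _ ⟨c, hc, rfl⟩
    rw [hτ, A.thetaH1_transportH1_cast_localization h c, hE c hc.2, map_zsmul]
  have hiso' : ∀ x ∈ (S ⊓ E).map (galoisCohomology.localization ρbar (Sum.inr q) 1),
      ∀ y ∈ (S ⊓ E).map (galoisCohomology.localization ρbar (Sum.inr q) 1), B x y = 0 := by
    rintro _ ⟨c, hc, rfl⟩ _ ⟨d, hd, rfl⟩
    rw [hB]
    exact hiso c hc.1 d hd.1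
  exact AddSubgroup.le_or_le_of_isotropic_of_eigen_of_nondegenerate B τ ε Lf Lt _ hdis hsplit hstabf hstabt hf ht
    hsymm horth hdecT hline' hnd h2 hS' hiso'

end DualityDatum

end Literature.NumberTheory.GaloisCohomology.Howard2004
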